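/-
Origin: expansion seat `planner-pub-hodgecm-prl2-g7-0`, handover #2 v2 2026-08-18T13:16Z md5 d8835b72 (SUPERSEDES bdf01422, code change: + all-characters forms; 110 l.; NEW additive leaf; rewrite `import Prl2g7.ThetaSpanFromBMM`→`import HodgeCM.StubTree.ThetaSpanFromBMM` (my #1, same run; lands AFTER #1); also imports tree `HodgeCM.Automorphic.SignRecipeEndStateAllChars` (RUN-29 install, prl1-g6); nothing imports it; fallback DROP) (`HOME/pub-hodgecm-prl2-g7/lean/Prl2g7/JunctionS1S2.lean`, md5 d8835b72, 110 lines);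
landed by the gen-8 packager in gate run 30 as `HodgeCM/StubTree/JunctionS1S2.lean` (import ^import Prl2g7\.ThetaSpanFromBMM[ \t]*$→import HodgeCM.StubTree.ThetaSpanFromBMM ×1).
-/
/-
Copyright (c) 2026. All rights reserved.
Released under Apache 2.0 license as described in the file LICENSE.
Authors: expansion seat `planner-pub-hodgecm-prl2-g7-0` (unit `pub-hodgecm-prl2-g7`, EXPANSION prover a-2, gen 7).
Target `HodgeCM/StubTree/JunctionS1S2.lean` (NEW additive leaf; one import rewrite `Prl2g7.ThetaSpanFromBMM` ↦
`HodgeCM.StubTree.ThetaSpanFromBMM`, this lineage's RUN-30 row #1; nothing imports this file).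
-/
import Summits.HodgeConjecture.HodgeCM.StubTree.ThetaSpanFromBMM_4
import Summits.HodgeConjecture.HodgeCM.Automorphic.SignRecipeEndStateAllChars_2

/-!
# Junction of the two realisation strategies — strategy 2's print route over strategy 1's constructed theta model
(generation 7 reconciliation of record, STATUS 2026-08-18T13:10:31Z, in kernel form)

Strategy 1 (prl1, CONSTRUCT) builds the theta model `C.thetaModel h d12 d34` from uniformisation data
`C : U.AdelicThetaCore₀`, PerL's sign recipe (bit `h`) and archimedean side data, and PROVES its two design facts
(`AdelicThetaCore.design_kappaConj`, `design_frameSignConj`).  Strategy 2 (prl2, REDUCE) proves `HC_CM` / `PerL` for a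
FREE theta model from print-sourced hypotheses plus exactly those two design facts.  Composing: over strategy 1's model
strategy 2's end state has NO design binder — the theorems below are one-line instantiations, recorded to show that the
two lineages' APIs meet at kernel level (junction build), and to make the reconciliation table of STATUS precise:
strategy 1's open input `thetaWedge` (N33) does not occur; in its place stand `Fact_virtualCup11₂` [M], the Liu supply
[P-IF], `IsoEmbFace` [P-IF] and `BMMGlueFace` [P by name ∧ P-IF ∧ M ∧ DESIGN].  The ALL-CHARACTERS forms track
strategy 1's generation-6 end state (`ThetaModel.allChars`, `AllCharsNonDesign`: the `chars` input N31 ELIMINATED by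
allowing every character): over `T.allChars` strategy 2's `chars` binder is prl1's theorem `allChars_chars`, and
`thetaGen12` / `thetaReal34` become their all-characters versions `Open_thetaGen12All` / `Open_thetaReal34All`.
-/

noncomputable section

namespace HodgeCM

namespace Universe

variable (U : Universe)

/-- **COR-CM over strategy 1's constructed theta model, by strategy 2's print route** — no design binder. -/
theorem COR_CM_of_liu_bmmGlue_adelic (M : U.ModelAxioms) (hV : U.Fact_virtualCup11₂) (hL : U.LiuSupplyFace)
    (h : Bool) (C : U.AdelicThetaCore₀) (d12 d34 : ∀ {L : CMField}, SeesawCtx L → SideData L)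
    (h₂ : (C.thetaModel h d12 d34).Fact_innerEmb) (h₅ : (C.thetaModel h d12 d34).Open_thetaSub)
    (h₇ : (C.thetaModel h d12 d34).Open_thetaGen12) (h₈ : (C.thetaModel h d12 d34).Open_thetaReal34)
    (h₉ : (C.thetaModel h d12 d34).Open_chars) (h₁₀ : (C.thetaModel h d12 d34).Open_occ)
    (hHR : U.Fact_hodgeRiemann20) {Hk : U.HeckeData} (hD : U.IsoEmbFace Hk (C.thetaModel h d12 d34))
    (hX : U.BMMGlueFace (C.thetaModel h d12 d34)) (hPo : U.PohlmannSpan) (hQ : U.Qw8Sufficiency) : U.HC_CM :=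
  U.COR_CM_of_liu_bmmGlue M hV hL h₂ h₅ h₇ h₈ h₉ h₁₀ hHR (C.design_kappaConj h d12 d34)
    (C.design_frameSignConj h d12 d34) hD hX hPo hQ

/-- **PerL over strategy 1's constructed theta model, by strategy 2's print route** — no design binder. -/
theorem perL_of_liu_bmmGlue_adelic (M : U.ModelAxioms) (hV : U.Fact_virtualCup11₂) (hL : U.LiuSupplyPerL)
    (h : Bool) (C : U.AdelicThetaCore₀) (d12 d34 : ∀ {L : CMField}, SeesawCtx L → SideData L)
    (h₂ : (C.thetaModel h d12 d34).Fact_innerEmb) (h₅ : (C.thetaModel h d12 d34).Open_thetaSub)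
    (h₇ : (C.thetaModel h d12 d34).Open_thetaGen12) (h₈ : (C.thetaModel h d12 d34).Open_thetaReal34)
    (h₉ : (C.thetaModel h d12 d34).Open_chars) (h₁₀ : (C.thetaModel h d12 d34).Open_occ)
    (hHR : U.Fact_hodgeRiemann20) {Hk : U.HeckeData} (hD : U.IsoEmbPerL Hk (C.thetaModel h d12 d34))
    (hX : U.BMMGluePerL (C.thetaModel h d12 d34)) : U.PerL :=
  U.perL_of_liu_bmmGlue M hV hL h₂ h₅ h₇ h₈ h₉ h₁₀ hHR (C.design_kappaConj h d12 d34)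
    (C.design_frameSignConj h d12 d34) hD hX

/-- **The same inputs as a strategy-1 record**: strategy 1's `NonDesignInputs` of the constructed model supplies
strategy 2's six theta-layer binders (`innerEmb`, `thetaSub`, `thetaGen12`, `thetaReal34`, `chars`, `occ`); its
remaining fields `embCover`, `thetaWedge` are NOT used. -/
theorem COR_CM_of_liu_bmmGlue_ofNonDesign (M : U.ModelAxioms) (hV : U.Fact_virtualCup11₂) (hL : U.LiuSupplyFace)
    (h : Bool) (C : U.AdelicThetaCore₀) (d12 d34 : ∀ {L : CMField}, SeesawCtx L → SideData L)
    (A : (C.thetaModel h d12 d34).NonDesignInputs)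
    (hHR : U.Fact_hodgeRiemann20) {Hk : U.HeckeData} (hD : U.IsoEmbFace Hk (C.thetaModel h d12 d34))
    (hX : U.BMMGlueFace (C.thetaModel h d12 d34)) (hPo : U.PohlmannSpan) (hQ : U.Qw8Sufficiency) : U.HC_CM :=
  U.COR_CM_of_liu_bmmGlue_adelic M hV hL h C d12 d34 A.innerEmb A.thetaSub A.thetaGen12 A.thetaReal34 A.chars
    A.occ hHR hD hX hPo hQ

/-- **COR-CM by strategy 2's print route over the ALL-CHARACTERS model `T.allChars` of ANY theta model `T`**
(strategy 1, generation 6): no `chars` binder (N31 eliminated — prl1's `ThetaModel.allChars_chars`), the pair-(12)/(34)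
isolation inputs in their all-characters forms, the design facts of `T` transported by `Iff.rfl`. -/
theorem COR_CM_of_liu_bmmGlue_allChars (M : U.ModelAxioms) (hV : U.Fact_virtualCup11₂) (hL : U.LiuSupplyFace)
    {T : U.ThetaModel} (h₂ : T.Fact_innerEmb) (h₅ : T.Open_thetaSub) (h₇ : T.Open_thetaGen12All)
    (h₈ : T.Open_thetaReal34All) (h₁₀ : T.Open_occ) (hHR : U.Fact_hodgeRiemann20)
    (hκ : T.Design_kappaConj) (hs : T.Design_frameSignConj)
    {Hk : U.HeckeData} (hD : U.IsoEmbFace Hk T.allChars) (hX : U.BMMGlueFace T.allChars)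
    (hPo : U.PohlmannSpan) (hQ : U.Qw8Sufficiency) : U.HC_CM :=
  U.COR_CM_of_liu_bmmGlue M hV hL (T := T.allChars) ((T.allChars_innerEmb_iff).mpr h₂)
    ((T.allChars_thetaSub_iff).mpr h₅) ((T.allChars_thetaGen12_iff).mpr h₇) ((T.allChars_thetaReal34_iff).mpr h₈)
    T.allChars_chars ((T.allChars_occ_iff).mpr h₁₀) hHR ((T.allChars_kappaConj_iff).mpr hκ)
    ((T.allChars_frameSignConj_iff).mpr hs) hD hX hPo hQ

/-- **PerL by strategy 2's print route over `T.allChars`** — no `chars` binder. -/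
theorem perL_of_liu_bmmGlue_allChars (M : U.ModelAxioms) (hV : U.Fact_virtualCup11₂) (hL : U.LiuSupplyPerL)
    {T : U.ThetaModel} (h₂ : T.Fact_innerEmb) (h₅ : T.Open_thetaSub) (h₇ : T.Open_thetaGen12All)
    (h₈ : T.Open_thetaReal34All) (h₁₀ : T.Open_occ) (hHR : U.Fact_hodgeRiemann20)
    (hκ : T.Design_kappaConj) (hs : T.Design_frameSignConj)
    {Hk : U.HeckeData} (hD : U.IsoEmbPerL Hk T.allChars) (hX : U.BMMGluePerL T.allChars) : U.PerL :=
  U.perL_of_liu_bmmGlue M hV hL (T := T.allChars) ((T.allChars_innerEmb_iff).mpr h₂)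
    ((T.allChars_thetaSub_iff).mpr h₅) ((T.allChars_thetaGen12_iff).mpr h₇) ((T.allChars_thetaReal34_iff).mpr h₈)
    T.allChars_chars ((T.allChars_occ_iff).mpr h₁₀) hHR ((T.allChars_kappaConj_iff).mpr hκ)
    ((T.allChars_frameSignConj_iff).mpr hs) hD hX

/-- **The two strategies' generation-6/7 end states composed**: strategy 1's all-characters record
`AllCharsNonDesign` of its CONSTRUCTED model supplies strategy 2's five remaining theta-layer binders; `embCover` and
`thetaWedge` (N33) are NOT used; no design binder, no `chars` binder. -/
theorem COR_CM_of_liu_bmmGlue_ofAllCharsNonDesign (M : U.ModelAxioms) (hV : U.Fact_virtualCup11₂)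
    (hL : U.LiuSupplyFace) (h : Bool) (C : U.AdelicThetaCore₀)
    (d12 d34 : ∀ {L : CMField}, SeesawCtx L → SideData L) (A : (C.thetaModel h d12 d34).AllCharsNonDesign)
    (hHR : U.Fact_hodgeRiemann20) {Hk : U.HeckeData} (hD : U.IsoEmbFace Hk (C.thetaModel h d12 d34).allChars)
    (hX : U.BMMGlueFace (C.thetaModel h d12 d34).allChars) (hPo : U.PohlmannSpan) (hQ : U.Qw8Sufficiency) :
    U.HC_CM :=
  U.COR_CM_of_liu_bmmGlue_allChars M hV hL A.innerEmb A.thetaSub A.thetaGen12All A.thetaReal34All A.occ hHR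
    (C.design_kappaConj h d12 d34) (C.design_frameSignConj h d12 d34) hD hX hPo hQ

end Universe

end HodgeCM

end
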